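import Literature.Probability.LatticeModels.IsingNestedConditioning
import HarnessLib

/-!
# DECOUPLING OF DISJOINT BLOCKS UNDER THE FINITE-VOLUME ISING MEASURES: TWO-SIDED PRODUCT BOUNDS FROM THE DOMAIN
# MARKOV PROPERTY (Friedli–Velenik 2017 Lemma 6.7; Lanford 1973 §A4; Föllmer–Orey 1988 §2)

Claimed R42 (8)(c) in the cell INBOX at 2026-08-29T11:54:27Z by fkp-10a gen 360 (NEW CLAIM #1 of the gen), addressed to the lane under (ι) (coordinator fk-4 gen 295 CLOSED l.8907 11:26:11Z 2026-08-29; «(ι) RESUMES») and to the next seated fk-4 generation (ruling R182 requested); lineage row FO-10a-g360 (self-suggested), package g360-plateau, label PL-A.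
Helper file of the `fk-continuity` build cell (bschramm lane; `--supports stmt-CriticalPhenomena-4575`; fkp-10a gen 360,
package g360-plateau, label PL-A); builds on p205010 (kernel theorem, internal audit signed; external expert review
pending). No definitions, no named facts, no sorries; standard axioms.
UNCONDITIONAL (nearest-neighbour Ising model on ANY locally finite graph, every real `β`
and `h`, fixed boundary conditions; no sign condition).
Scope: two-sided product bounds for block events under the finite-volume Ising measures with FIXED boundary
conditions; no infinite-volume statement; nothing percolation-bearing.

The consistency of the Ising kernels (`lintegral_isingMeasure_fixed_consistent`: `μ^η_Λ = μ^η_Λ γ_C` for `C ⊆ Λ`)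
and the fact that an event determined by the spins off `C` is decided by the boundary condition of `γ_C`
(`isingMeasure_fixed_inter_of_determined_off`) give, for a block `C ⊆ Λ`, a measurable event `A` and an event `B`
determined off `C`:

* `mul_le_isingMeasure_fixed_inter` — **LOWER block bound**: if `p ≤ μ^ζ_{C;β,h}(A)` for EVERY boundary condition
  `ζ`, then `p · μ^η_{Λ;β,h}(B) ≤ μ^η_{Λ;β,h}(A ∩ B)` (the mirror image of the tree's upper bound
  `isingMeasure_fixed_inter_le_mul`); real-valued form `mul_le_isingMeasure_fixed_real_inter`;
* `isingMeasure_fixed_inter_mem_Icc` — the two-sided sandwich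
  `p μ(B) ≤ μ(A ∩ B) ≤ P μ(B)` when `p ≤ μ^ζ_C(A) ≤ P` for all `ζ`;
* `prod_le_isingMeasure_fixed_biInter` / `isingMeasure_fixed_biInter_le_prod` — **DISJOINT BLOCKS ARE
  QUASI-INDEPENDENT**: for pairwise disjoint blocks `C_i ⊆ Λ` (`i ∈ s`) and events `A_i` determined by the spins
  in `C_i`, uniform bounds `p_i ≤ μ^ζ_{C_i}(A_i) ≤ P_i` (all `ζ`) give
  `∏_{i∈s} p_i ≤ μ^η_Λ(⋂_{i∈s} A_i) ≤ ∏_{i∈s} P_i` for every `η` (induction over the blocks: `⋂_{j≠i} A_j` is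
  determined off `C_i`); real-valued forms `prod_le_isingMeasure_fixed_real_biInter`,
  `isingMeasure_fixed_real_biInter_le_prod`.

These are the block estimates behind sub-additivity proofs of large-deviation lower bounds (Lanford 1973; Föllmer–Orey
1988, §2; Olla 1988, §5): the sequel `MagnetizationPlateauLowerBound` tiles `Λ_N` by translates of `Λ_n` and
multiplies uniform-in-the-boundary-condition window bounds.

## References

* S. Friedli, Y. Velenik, *Statistical Mechanics of Lattice Systems*, CUP (2017), §6.2 Lemma 6.7 (compatibility of
  the Ising kernels), Exercise 6.21. [FriedliVelenik2017]
* O. E. Lanford, *Entropy and equilibrium states in classical statistical mechanics*, LNP 20, Springer (1973), §A4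
  (sub-additivity over disjoint boxes). [Lanford1973]
* H. Föllmer, S. Orey, *Large deviations for the empirical field of a Gibbs measure*, Ann. Probab. 16 (1988), §2.
  [FollmerOrey1988]
* S. Olla, *Large deviations for Gibbs random fields*, PTRF 77 (1988), §5. [Olla1988]
-/

noncomputable section

namespace Summit.CriticalPhenomena.PercolationContinuityZ3.Theorems.FK

namespace IsingLargeDeviations

open MeasureTheory Finset Set
open scoped ENNReal
open Literature.Probability.LatticeModels

variable {V : Type*} (G : SimpleGraph V) [DecidableEq V] [G.LocallyFinite]

/-! ### One block: the lower bound and the two-sided sandwich -/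

/-- **LOWER BLOCK BOUND**: for `C ⊆ Λ`, `A` measurable, `B` measurable and determined by the spins off `C`, and
`p ≤ μ^ζ_{C;β,h}(A)` for every boundary condition `ζ`: `p · μ^η_{Λ;β,h}(B) ≤ μ^η_{Λ;β,h}(A ∩ B)`
(consistency `μ^η_Λ(A ∩ B) = ∫_B μ^σ_C(A) dμ^η_Λ(σ)`). [cite: FriedliVelenik2017, Lemma 6.7; Lanford1973, §A4] -/
theorem mul_le_isingMeasure_fixed_inter {C Λ : Finset V} (hsub : C ⊆ Λ) (β h : ℝ) (η : SpinConfig V)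
    {A B : Set (SpinConfig V)} (hA : MeasurableSet A) (hB : MeasurableSet B)
    (hBdet : ∀ σ₁ σ₂ : SpinConfig V, (∀ x ∉ C, σ₁ x = σ₂ x) → (σ₁ ∈ B ↔ σ₂ ∈ B))
    {p : ℝ≥0∞} (hp : ∀ ζ : SpinConfig V, p ≤ isingMeasure G C β h (.fixed ζ) A) :
    p * isingMeasure G Λ β h (.fixed η) B ≤ isingMeasure G Λ β h (.fixed η) (A ∩ B) := by
  rw [← lintegral_isingMeasure_fixed_consistent G hsub β h η (hA.inter hB)]
  simp_rw [isingMeasure_fixed_inter_of_determined_off G C β h _ hA hB hBdet]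
  calc p * isingMeasure G Λ β h (.fixed η) B
      = ∫⁻ σ, B.indicator (fun _ ↦ p) σ ∂isingMeasure G Λ β h (.fixed η) := by
        rw [lintegral_indicator hB, setLIntegral_const, mul_comm]
    _ ≤ ∫⁻ σ, B.indicator (fun _ ↦ isingMeasure G C β h (.fixed σ) A) σ ∂isingMeasure G Λ β h (.fixed η) := by
        refine lintegral_mono fun σ ↦ ?_
        by_cases hσ : σ ∈ B
        · rw [Set.indicator_of_mem hσ, Set.indicator_of_mem hσ]; exact hp σ
        · rw [Set.indicator_of_notMem hσ, Set.indicator_of_notMem hσ]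

/-- **TWO-SIDED BLOCK SANDWICH**: `p μ^η_Λ(B) ≤ μ^η_Λ(A ∩ B) ≤ P μ^η_Λ(B)` whenever `p ≤ μ^ζ_C(A) ≤ P` for every
boundary condition `ζ` (`C ⊆ Λ`, `B` determined off `C`). [cite: FriedliVelenik2017, Lemma 6.7; FollmerOrey1988, §2] -/
theorem isingMeasure_fixed_inter_mem_Icc {C Λ : Finset V} (hsub : C ⊆ Λ) (β h : ℝ) (η : SpinConfig V)
    {A B : Set (SpinConfig V)} (hA : MeasurableSet A) (hB : MeasurableSet B)
    (hBdet : ∀ σ₁ σ₂ : SpinConfig V, (∀ x ∉ C, σ₁ x = σ₂ x) → (σ₁ ∈ B ↔ σ₂ ∈ B))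
    {p P : ℝ≥0∞} (hp : ∀ ζ : SpinConfig V, p ≤ isingMeasure G C β h (.fixed ζ) A)
    (hP : ∀ ζ : SpinConfig V, isingMeasure G C β h (.fixed ζ) A ≤ P) :
    isingMeasure G Λ β h (.fixed η) (A ∩ B) ∈
      Set.Icc (p * isingMeasure G Λ β h (.fixed η) B) (P * isingMeasure G Λ β h (.fixed η) B) :=
  ⟨mul_le_isingMeasure_fixed_inter G hsub β h η hA hB hBdet hp,
    isingMeasure_fixed_inter_le_mul G hsub β h η hA hB hBdet hP⟩

/-- **LOWER BLOCK BOUND, real form**: `p · μ^η_Λ.real(B) ≤ μ^η_Λ.real(A ∩ B)` when `0 ≤ p ≤ μ^ζ_C.real(A)` for all `ζ`.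
[cite: FriedliVelenik2017, Lemma 6.7; Lanford1973, §A4] -/
theorem mul_le_isingMeasure_fixed_real_inter {C Λ : Finset V} (hsub : C ⊆ Λ) (β h : ℝ) (η : SpinConfig V)
    {A B : Set (SpinConfig V)} (hA : MeasurableSet A) (hB : MeasurableSet B)
    (hBdet : ∀ σ₁ σ₂ : SpinConfig V, (∀ x ∉ C, σ₁ x = σ₂ x) → (σ₁ ∈ B ↔ σ₂ ∈ B))
    {p : ℝ} (hp0 : 0 ≤ p) (hp : ∀ ζ : SpinConfig V, p ≤ (isingMeasure G C β h (.fixed ζ)).real A) :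
    p * (isingMeasure G Λ β h (.fixed η)).real B ≤ (isingMeasure G Λ β h (.fixed η)).real (A ∩ B) := by
  have hp' : ∀ ζ : SpinConfig V, ENNReal.ofReal p ≤ isingMeasure G C β h (.fixed ζ) A := fun ζ ↦ by
    rw [← ENNReal.ofReal_toReal (measure_ne_top _ A)]
    exact ENNReal.ofReal_le_ofReal (hp ζ)
  have h1 := mul_le_isingMeasure_fixed_inter G hsub β h η hA hB hBdet hp'
  rw [measureReal_def, measureReal_def, ← ENNReal.toReal_ofReal hp0, ← ENNReal.toReal_mul]
  exact ENNReal.toReal_mono (measure_ne_top _ _) h1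

/-! ### Pairwise disjoint blocks: product lower and upper bounds -/

omit [DecidableEq V] in
/-- An intersection of events each determined by the spins of its own block is determined by the spins off any
block disjoint from all of them. [folklore] -/
theorem biInter_determined_off {ι : Type*} (s : Finset ι) (C : ι → Finset V) (A : ι → Set (SpinConfig V))
    (hAdet : ∀ i ∈ s, ∀ σ₁ σ₂ : SpinConfig V, (∀ x ∈ C i, σ₁ x = σ₂ x) → (σ₁ ∈ A i ↔ σ₂ ∈ A i))
    {D : Finset V} (hD : ∀ i ∈ s, Disjoint (C i) D) (σ₁ σ₂ : SpinConfig V) (h : ∀ x ∉ D, σ₁ x = σ₂ x) :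
    σ₁ ∈ (⋂ i ∈ s, A i) ↔ σ₂ ∈ ⋂ i ∈ s, A i := by
  simp only [Set.mem_iInter]
  refine forall₂_congr fun i hi ↦ hAdet i hi σ₁ σ₂ fun x hx ↦ h x ?_
  exact Finset.disjoint_left.1 (hD i hi) hx

/-- **PRODUCT LOWER BOUND OVER DISJOINT BLOCKS**: pairwise disjoint blocks `C_i ⊆ Λ` (`i ∈ s`), measurable events
`A_i` determined by the spins in `C_i`, and `p_i ≤ μ^ζ_{C_i;β,h}(A_i)` for every boundary condition `ζ`; then
`∏_{i∈s} p_i ≤ μ^η_{Λ;β,h}(⋂_{i∈s} A_i)` for every `η`. [cite: Lanford1973, §A4; FollmerOrey1988, §2; Olla1988, §5] -/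
theorem prod_le_isingMeasure_fixed_biInter {ι : Type*} (s : Finset ι) {Λ : Finset V} (C : ι → Finset V)
    (hsub : ∀ i ∈ s, C i ⊆ Λ) (hdisj : ∀ i ∈ s, ∀ j ∈ s, i ≠ j → Disjoint (C i) (C j)) (β h : ℝ)
    (A : ι → Set (SpinConfig V)) (hAm : ∀ i ∈ s, MeasurableSet (A i))
    (hAdet : ∀ i ∈ s, ∀ σ₁ σ₂ : SpinConfig V, (∀ x ∈ C i, σ₁ x = σ₂ x) → (σ₁ ∈ A i ↔ σ₂ ∈ A i))
    (p : ι → ℝ≥0∞) (hp : ∀ i ∈ s, ∀ ζ : SpinConfig V, p i ≤ isingMeasure G (C i) β h (.fixed ζ) (A i))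
    (η : SpinConfig V) :
    ∏ i ∈ s, p i ≤ isingMeasure G Λ β h (.fixed η) (⋂ i ∈ s, A i) := by
  classical
  induction s using Finset.induction_on with
  | empty => simp
  | @insert j s hj ih =>
    have hmeas : MeasurableSet (⋂ i ∈ s, A i) :=
      MeasurableSet.biInter s.countable_toSet fun i hi ↦ hAm i (Finset.mem_insert_of_mem hi)
    have hdet : ∀ σ₁ σ₂ : SpinConfig V, (∀ x ∉ C j, σ₁ x = σ₂ x) → (σ₁ ∈ (⋂ i ∈ s, A i) ↔ σ₂ ∈ ⋂ i ∈ s, A i) :=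
      biInter_determined_off s C A (fun i hi ↦ hAdet i (Finset.mem_insert_of_mem hi))
        (fun i hi ↦ (hdisj j (Finset.mem_insert_self j s) i (Finset.mem_insert_of_mem hi)
          (fun hji ↦ hj (hji ▸ hi))).symm)
    rw [Finset.prod_insert hj, Finset.set_biInter_insert]
    calc p j * ∏ i ∈ s, p i ≤ p j * isingMeasure G Λ β h (.fixed η) (⋂ i ∈ s, A i) := by
          gcongr
          exact ih (fun i hi ↦ hsub i (Finset.mem_insert_of_mem hi))
            (fun i hi k hk ↦ hdisj i (Finset.mem_insert_of_mem hi) k (Finset.mem_insert_of_mem hk))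
            (fun i hi ↦ hAm i (Finset.mem_insert_of_mem hi)) (fun i hi ↦ hAdet i (Finset.mem_insert_of_mem hi))
            (fun i hi ↦ hp i (Finset.mem_insert_of_mem hi))
      _ ≤ isingMeasure G Λ β h (.fixed η) (A j ∩ ⋂ i ∈ s, A i) :=
          mul_le_isingMeasure_fixed_inter G (hsub j (Finset.mem_insert_self j s)) β h η
            (hAm j (Finset.mem_insert_self j s)) hmeas hdet (hp j (Finset.mem_insert_self j s))

/-- **PRODUCT UPPER BOUND OVER DISJOINT BLOCKS**: with `μ^ζ_{C_i;β,h}(A_i) ≤ P_i` for every `ζ` instead,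
`μ^η_{Λ;β,h}(⋂_{i∈s} A_i) ≤ ∏_{i∈s} P_i`. [cite: FollmerOrey1988, §2; Olla1988, §5; FriedliVelenik2017, Lemma 6.7] -/
theorem isingMeasure_fixed_biInter_le_prod {ι : Type*} (s : Finset ι) {Λ : Finset V} (C : ι → Finset V)
    (hsub : ∀ i ∈ s, C i ⊆ Λ) (hdisj : ∀ i ∈ s, ∀ j ∈ s, i ≠ j → Disjoint (C i) (C j)) (β h : ℝ)
    (A : ι → Set (SpinConfig V)) (hAm : ∀ i ∈ s, MeasurableSet (A i))
    (hAdet : ∀ i ∈ s, ∀ σ₁ σ₂ : SpinConfig V, (∀ x ∈ C i, σ₁ x = σ₂ x) → (σ₁ ∈ A i ↔ σ₂ ∈ A i))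
    (P : ι → ℝ≥0∞) (hP : ∀ i ∈ s, ∀ ζ : SpinConfig V, isingMeasure G (C i) β h (.fixed ζ) (A i) ≤ P i)
    (η : SpinConfig V) :
    isingMeasure G Λ β h (.fixed η) (⋂ i ∈ s, A i) ≤ ∏ i ∈ s, P i := by
  classical
  induction s using Finset.induction_on with
  | empty => simp
  | @insert j s hj ih =>
    have hmeas : MeasurableSet (⋂ i ∈ s, A i) :=
      MeasurableSet.biInter s.countable_toSet fun i hi ↦ hAm i (Finset.mem_insert_of_mem hi)
    have hdet : ∀ σ₁ σ₂ : SpinConfig V, (∀ x ∉ C j, σ₁ x = σ₂ x) → (σ₁ ∈ (⋂ i ∈ s, A i) ↔ σ₂ ∈ ⋂ i ∈ s, A i) :=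
      biInter_determined_off s C A (fun i hi ↦ hAdet i (Finset.mem_insert_of_mem hi))
        (fun i hi ↦ (hdisj j (Finset.mem_insert_self j s) i (Finset.mem_insert_of_mem hi)
          (fun hji ↦ hj (hji ▸ hi))).symm)
    rw [Finset.prod_insert hj, Finset.set_biInter_insert]
    calc isingMeasure G Λ β h (.fixed η) (A j ∩ ⋂ i ∈ s, A i)
        ≤ P j * isingMeasure G Λ β h (.fixed η) (⋂ i ∈ s, A i) :=
          isingMeasure_fixed_inter_le_mul G (hsub j (Finset.mem_insert_self j s)) β h η
            (hAm j (Finset.mem_insert_self j s)) hmeas hdet (hP j (Finset.mem_insert_self j s))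
      _ ≤ P j * ∏ i ∈ s, P i := by
          gcongr
          exact ih (fun i hi ↦ hsub i (Finset.mem_insert_of_mem hi))
            (fun i hi k hk ↦ hdisj i (Finset.mem_insert_of_mem hi) k (Finset.mem_insert_of_mem hk))
            (fun i hi ↦ hAm i (Finset.mem_insert_of_mem hi)) (fun i hi ↦ hAdet i (Finset.mem_insert_of_mem hi))
            (fun i hi ↦ hP i (Finset.mem_insert_of_mem hi))

/-- **PRODUCT LOWER BOUND, real form**: `∏_{i∈s} p_i ≤ μ^η_Λ.real(⋂_{i∈s} A_i)` when `0 ≤ p_i ≤ μ^ζ_{C_i}.real(A_i)`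
for all `ζ`. [cite: Lanford1973, §A4; FollmerOrey1988, §2] -/
theorem prod_le_isingMeasure_fixed_real_biInter {ι : Type*} (s : Finset ι) {Λ : Finset V} (C : ι → Finset V)
    (hsub : ∀ i ∈ s, C i ⊆ Λ) (hdisj : ∀ i ∈ s, ∀ j ∈ s, i ≠ j → Disjoint (C i) (C j)) (β h : ℝ)
    (A : ι → Set (SpinConfig V)) (hAm : ∀ i ∈ s, MeasurableSet (A i))
    (hAdet : ∀ i ∈ s, ∀ σ₁ σ₂ : SpinConfig V, (∀ x ∈ C i, σ₁ x = σ₂ x) → (σ₁ ∈ A i ↔ σ₂ ∈ A i))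
    (p : ι → ℝ) (hp0 : ∀ i ∈ s, 0 ≤ p i)
    (hp : ∀ i ∈ s, ∀ ζ : SpinConfig V, p i ≤ (isingMeasure G (C i) β h (.fixed ζ)).real (A i))
    (η : SpinConfig V) :
    ∏ i ∈ s, p i ≤ (isingMeasure G Λ β h (.fixed η)).real (⋂ i ∈ s, A i) := by
  have hp' : ∀ i ∈ s, ∀ ζ : SpinConfig V, ENNReal.ofReal (p i) ≤ isingMeasure G (C i) β h (.fixed ζ) (A i) :=
    fun i hi ζ ↦ by
      rw [← ENNReal.ofReal_toReal (measure_ne_top _ (A i))]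
      exact ENNReal.ofReal_le_ofReal (hp i hi ζ)
  have h1 := prod_le_isingMeasure_fixed_biInter G s C hsub hdisj β h A hAm hAdet (fun i ↦ ENNReal.ofReal (p i)) hp' η
  rw [← ENNReal.ofReal_prod_of_nonneg hp0] at h1
  rw [measureReal_def, ← ENNReal.toReal_ofReal (Finset.prod_nonneg hp0)]
  exact ENNReal.toReal_mono (measure_ne_top _ _) h1

/-- **PRODUCT UPPER BOUND, real form**: `μ^η_Λ.real(⋂_{i∈s} A_i) ≤ ∏_{i∈s} P_i` when `μ^ζ_{C_i}.real(A_i) ≤ P_i` for all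
`ζ`. [cite: FollmerOrey1988, §2; Olla1988, §5] -/
theorem isingMeasure_fixed_real_biInter_le_prod {ι : Type*} (s : Finset ι) {Λ : Finset V} (C : ι → Finset V)
    (hsub : ∀ i ∈ s, C i ⊆ Λ) (hdisj : ∀ i ∈ s, ∀ j ∈ s, i ≠ j → Disjoint (C i) (C j)) (β h : ℝ)
    (A : ι → Set (SpinConfig V)) (hAm : ∀ i ∈ s, MeasurableSet (A i))
    (hAdet : ∀ i ∈ s, ∀ σ₁ σ₂ : SpinConfig V, (∀ x ∈ C i, σ₁ x = σ₂ x) → (σ₁ ∈ A i ↔ σ₂ ∈ A i))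
    (P : ι → ℝ) (hP : ∀ i ∈ s, ∀ ζ : SpinConfig V, (isingMeasure G (C i) β h (.fixed ζ)).real (A i) ≤ P i)
    (η : SpinConfig V) :
    (isingMeasure G Λ β h (.fixed η)).real (⋂ i ∈ s, A i) ≤ ∏ i ∈ s, P i := by
  have hP0 : ∀ i ∈ s, 0 ≤ P i := fun i hi ↦ measureReal_nonneg.trans (hP i hi 1)
  have hP' : ∀ i ∈ s, ∀ ζ : SpinConfig V, isingMeasure G (C i) β h (.fixed ζ) (A i) ≤ ENNReal.ofReal (P i) :=
    fun i hi ζ ↦ by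
      rw [← ENNReal.ofReal_toReal (measure_ne_top _ (A i))]
      exact ENNReal.ofReal_le_ofReal (hP i hi ζ)
  have h1 := isingMeasure_fixed_biInter_le_prod G s C hsub hdisj β h A hAm hAdet (fun i ↦ ENNReal.ofReal (P i)) hP' η
  rw [← ENNReal.ofReal_prod_of_nonneg hP0] at h1
  rw [measureReal_def, ← ENNReal.toReal_ofReal (Finset.prod_nonneg hP0)]
  exact ENNReal.toReal_mono ENNReal.ofReal_ne_top h1

end IsingLargeDeviations

end Summit.CriticalPhenomena.PercolationContinuityZ3.Theorems.FK
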